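import Literature.MathematicalPhysics.QuantumFieldTheory.Balaban1983to89.Node00.ROperationOfRecord

/-!
# NODE 00 — DEFINER ₇, FILE 6 (v1.1, repair (R3) of chair R437): `R` of record with the ALMOST-EVERYWHERE admissibility —
# (0.3) [IV] returns the EXPLICIT formula on every density a.e.-equal to a represented one, (0.4) for every density by ONE
# `integral_congr_ae`; an append-only successor of FILE 2 (`Node00.ROperationOfRecord`), nothing landed is edited

Seat `pub-ymgap-node00-def-R` (DEFINER ₇).  [IV] = [Balaban1989LargeFieldI], [III] = [Balaban1988Convergent].

WHY (dag-n13-b's kernel certificate [N13-B-G2-STAGE7-POINTWISE], chair ★★ R437 (2), evidence #14 on item 19183).  FILE 2's `R` of record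
is n12-b's `B15RopTotal.ropTotal`, whose admissibility `Admissible rep ρ := (rep ρ).total = ρ ∧ Provisos` asks POINTWISE equality of the
represented density with the density the operation is applied to.  In the machine of record that density is `Tρ_k`, a Radon–Nikodym
VERSION (`AveragingRT.rnTransport`), so the pointwise equality is provable for no representation and the (0.3) branch never provably
fires — a vacuity repaired by impossibility, not the intended repair.  THE CUT (R3): ask `(rep ρ).total =ᵐ[dV] ρ` instead.  Then (0.4)
`PreservesIntegral` and integrability survive VERBATIM for EVERY density (b01's `integral_ropReal_eq` + one `integral_congr_ae`), the new
density on the admissible branch is the EXPLICIT (0.3) formula `(rep ρ).rop` (pointwise meaningful, non-negative), and admissibility IS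
provable for a representation with the printed provisos whose total is a.e.-equal to the transported density — genuine [III]∕[IV] content
(«T of a represented density is represented», Theorem 1 [III]; the N-cells'), which a junk machine cannot offer.

WHAT THIS FILE IS.  §1 the generic a.e. layer over `B15RopTotal.RepData` — `AdmissibleAE`, `ropTotalAE`, `ropTotalAE_of_admissible ∕ _of_not`,
`admissibleAE_of_admissible` (FILE 2's branch ⊆ the new one), `preservesIntegral_ropTotalAE` ((0.4) ∀ρ), `integrable_ropTotalAE` (∀ρ),
`ropTotalAE_nonneg`, `admissibleAE_intro` — these eight are dag-n13-b's DESK BYTES [N13-B-G2-DESK-OFFER-R3] (`RopTotalAE.lean` 569e169a15dd0d03),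
re-homed here verbatim up to namespace at their invitation («rename ∕ re-home at will»); §2 the NODE 00 pin in the exact shapes of
`Node00.Record5.Residual₅`: **`ROp03AEOfRecord rep p k := ropTotalAE (rep p k)`**, **`preservesIntegral_ROp03AEOfRecord`**, **`integrable_ROp03AEOfRecord`**
(drop-in replacements of FILE 2's three names in node00-def's plug), `ROp03AEOfRecord_of_admissibleAE ∕ _of_not`, and the agreement with FILE 2
on its own branch (`ROp03AEOfRecord_eq_of_admissible`); §3 the (R3) PIN SHAPE for a represented tower carried as `RepData` per run and step
(`RepDataTower`; dag-n12-b's `TowerOfRecord` gives one by `TowerRep.toRepData`): **`repOfDataAE T p k ρ := if (T p k).total =ᵐ[dV] ρ then T p k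
else trivialRep ρ`** — Bałaban's data on every density A.E.-EQUAL to the tower's total (so on the transported `Tρ_k` once the a.e. identity
is PROVED), the one-region convention elsewhere — with `repOfDataAE_of_ae ∕ _of_not_ae`, `admissibleAE_repOfDataAE_of_ae`, and
**`ROp03AEOfRecord_repOfDataAE_of_ae`**: under `(T p k).total =ᵐ ρ` and the provisos, `R` of record at `ρ` IS the explicit (0.3) of the tower.

HONEST SCOPE.  Definitions of record + kernel bookkeeping; the one analytic input used is b01's PROVED fibre lemma (`B15.BasicStep.integral_ropReal_eq`,
`integrable_normTerm`).  `Provisos` keeps b01's UNIFORMLY BOUNDED pieces (the chair's «integrable pieces» would need b01's fibre lemma under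
integrability — finiteness of the fibre marginals only a.e. —, a separate measure-theory item; no loss for genuine data: continuous pieces on
the compact `SU(N)^{bonds}` are bounded).  Nothing of Bałaban's asserted: NOT that any density of the record is a.e.-represented (Theorem 1 [III],
N-cells ∕ DEFINER ₉), no positivity, no estimate; (0.4) holds for every density because the non-admissible branch is the identity — labelled.
Stage-5 (`TrhoOfRecord` as an `rnDeriv` version) is untouched: (R2) = the represented tower ₉ is node00-def's design of record (R437 (1)); this
is the cut (R437 (2)).  Counts unmoved (typed 28∕28 · discharged 1∕28); nothing continuum ∕ ℝ⁴ ∕ OS ∕ mass-gap ∕ Clay.  No `sorry` ∕ `axiom` ∕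
`opaque` ∕ `instance` ∕ `notation`.
-/

noncomputable section

open MeasureTheory
open scoped BigOperators

namespace Literature.MathematicalPhysics.QuantumFieldTheory.Balaban1983to89.Node00

open T4Continuum B15RopTotal
open B15.BasicStep (fibreIntegral normTerm RopReal)

/-! ## §1  The a.e. admissibility and the total operator (dag-n13-b's desk bytes, re-homed) -/

section GenericAE

variable {P : Params} {j : ℕ} {G : Type*} [GaugeGroup G] [MeasurableSpace G] [HaarData G]

/-- **Admissibility, a.e. reading** (R437 (2)): the datum represents `ρ` ALMOST EVERYWHERE for `dV` and satisfies the printed provisos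
of p. 176 (measurable, non-negative, uniformly bounded pieces; nowhere-vanishing denominators).  dag-n13-b's `AdmissibleAE`.
[cite: Balaban1989LargeFieldI, (0.2)–(0.3) p.176] -/
def AdmissibleAE [DecidableEq (PBond P j)] (rep : Density P j G → RepData P j G) (ρ : Density P j G) : Prop :=
  (rep ρ).total =ᵐ[fieldMeasure P j G] ρ ∧ (rep ρ).Provisos

open Classical in
/-- **`R` totalised with the a.e. admissibility**: (0.3) of the datum — *"(𝐑ρ)(V) = Σ_Z ρ(Z″, V) ∫dV⌈_{Z′} ρ(Z, V) [∫dV⌈_{Z′} ρ(Z″, V)]⁻¹"* —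
on the a.e.-admissible densities, the identity elsewhere.  dag-n13-b's `ropTotalAE`. [cite: Balaban1989LargeFieldI, (0.3) p.176] -/
def ropTotalAE (rep : Density P j G → RepData P j G) : Density P j G → Density P j G :=
  fun ρ => if AdmissibleAE rep ρ then (rep ρ).rop else ρ

open Classical in
/-- The admissible branch returns the EXPLICIT (0.3) formula. [cite: Balaban1989LargeFieldI, (0.3) p.176 (bookkeeping)] -/
theorem ropTotalAE_of_admissible {rep : Density P j G → RepData P j G} {ρ : Density P j G} (h : AdmissibleAE rep ρ) :
    ropTotalAE rep ρ = (rep ρ).rop :=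
  if_pos h

open Classical in
/-- The non-admissible branch is the identity (typing convention, labelled). [cite: Balaban1989LargeFieldI, (0.3) p.176 (typing convention)] -/
theorem ropTotalAE_of_not {rep : Density P j G → RepData P j G} {ρ : Density P j G} (h : ¬ AdmissibleAE rep ρ) :
    ropTotalAE rep ρ = ρ :=
  if_neg h

open Classical in
/-- FILE 2's pointwise admissibility implies the a.e. one (the old branch is contained in the new). [cite: Balaban1989LargeFieldI, (0.3) p.176 (bookkeeping)] -/
theorem admissibleAE_of_admissible {rep : Density P j G → RepData P j G} {ρ : Density P j G} (h : Admissible rep ρ) :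
    AdmissibleAE rep ρ :=
  ⟨Filter.EventuallyEq.of_eq h.1, h.2⟩

open Classical in
/-- **(0.4) for EVERY density under the a.e. reading**: `∫ (Rρ) dV = ∫ ρ dV` — on the admissible branch b01's `integral_ropReal_eq` gives
`∫ rop = ∫ Σ_Z ρ(Z, ·)` and `Σ_Z ρ(Z, ·) =ᵐ ρ` finishes by `integral_congr_ae`; the other branch is the identity.  dag-n13-b's proof.
[cite: Balaban1989LargeFieldI, (0.4) p.176] -/
theorem preservesIntegral_ropTotalAE (rep : Density P j G → RepData P j G) : PreservesIntegral (ropTotalAE rep) := by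
  intro ρ
  by_cases h : AdmissibleAE rep ρ
  · rw [ropTotalAE_of_admissible h]
    obtain ⟨hae, hm, h0, ⟨C, hC⟩, hden⟩ := h
    letI := (rep ρ).fin
    have h1 := B15.BasicStep.integral_ropReal_eq (rep ρ).piece (rep ρ).pp (rep ρ).fib hm h0 hC hden
    unfold RepData.rop
    rw [h1]
    exact integral_congr_ae hae
  · rw [ropTotalAE_of_not h]

open Classical in
/-- Integrability is preserved, for EVERY density (admissible branch: each (0.3)-term is integrable by b01's `integrable_normTerm`).
[cite: Balaban1989LargeFieldI, (0.3)–(0.4) p.176 (bookkeeping)] -/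
theorem integrable_ropTotalAE (rep : Density P j G → RepData P j G) {ρ : Density P j G}
    (hρ : Integrable ρ (fieldMeasure P j G)) : Integrable (ropTotalAE rep ρ) (fieldMeasure P j G) := by
  by_cases h : AdmissibleAE rep ρ
  · rw [ropTotalAE_of_admissible h]
    letI := (rep ρ).fin
    obtain ⟨-, hm, h0, ⟨C, hC⟩, hden⟩ := h
    have hterm : ∀ Z, Integrable (normTerm ((rep ρ).fib Z) ((rep ρ).piece ((rep ρ).pp Z)) ((rep ρ).piece Z))
        (fieldMeasure P j G) :=
      fun Z => B15.BasicStep.integrable_normTerm _ (hm _) (hm _) (h0 _) (hC _) (hC _) (hden Z)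
    exact integrable_finsetSum _ fun Z _ => hterm Z
  · rw [ropTotalAE_of_not h]; exact hρ

open Classical in
/-- On the admissible branch the new density is non-negative POINTWISE (it is the explicit (0.3) formula). [cite: Balaban1989LargeFieldI, (0.3) p.176 («the densities are positive»)] -/
theorem ropTotalAE_nonneg {rep : Density P j G → RepData P j G} {ρ : Density P j G} (h : AdmissibleAE rep ρ)
    (V : GaugeField P j G) : 0 ≤ ropTotalAE rep ρ V := by
  rw [ropTotalAE_of_admissible h]
  letI := (rep ρ).fin
  obtain ⟨-, -, h0, -, -⟩ := h
  unfold RepData.rop B15.BasicStep.RopReal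
  refine Finset.sum_nonneg fun Z _ => ?_
  unfold B15.BasicStep.normTerm B15.BasicStep.fibreIntegral
  exact mul_nonneg (h0 _ _) (div_nonneg ENNReal.toReal_nonneg ENNReal.toReal_nonneg)

open Classical in
/-- **The point of the repair**: a representation with the provisos whose total is a.e.-equal to the density IS admissible — only the a.e.
identity is needed, which is what a push-forward ∕ Radon–Nikodym argument delivers for the transported density. [cite: Balaban1989LargeFieldI, (0.2) p.176; Balaban1988Convergent, Theorem 1 p.262] -/
theorem admissibleAE_intro (rep : Density P j G → RepData P j G) (ρ : Density P j G)
    (hae : (rep ρ).total =ᵐ[fieldMeasure P j G] ρ) (hprov : (rep ρ).Provisos) : AdmissibleAE rep ρ :=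
  ⟨hae, hprov⟩

end GenericAE

/-! ## §2  The NODE 00 pin: `R` of record (v1.1) in the shapes of `Residual₅` -/

section Pin

variable (F : T4Family) (N : ℕ) [NeZero N]

open Classical in
/-- **`R` OF RECORD (v1.1)**: n13-b's a.e.-admissible total operator at FILE 2's residual datum `rep p k` — fills `Residual₅.R` in place of
`ROp03OfRecord`. [cite: Balaban1989LargeFieldI, (0.3) p.176] -/
def ROp03AEOfRecord (rep : RepOfRecord F N) (p : B12.RunParams) (k : ℕ) :
    Density (F.P p.K) (k + 1) (SU N) → Density (F.P p.K) (k + 1) (SU N) :=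
  ropTotalAE (rep p k)

open Classical in
/-- Unfolding. [cite: Balaban1989LargeFieldI, (0.3) p.176 (bookkeeping)] -/
theorem ROp03AEOfRecord_eq (rep : RepOfRecord F N) (p : B12.RunParams) (k : ℕ) :
    ROp03AEOfRecord F N rep p k = ropTotalAE (rep p k) := rfl

open Classical in
/-- **(0.4) [IV] for `R` of record (v1.1), for every run, step and density** — fills `Residual₅.preservesIntegral_R` (the guard `k < p.K` of the
field is not needed and not used). [cite: Balaban1989LargeFieldI, (0.4) p.176] -/
theorem preservesIntegral_ROp03AEOfRecord (rep : RepOfRecord F N) :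
    ∀ (p : B12.RunParams) (k : ℕ), k < p.K → PreservesIntegral (ROp03AEOfRecord F N rep p k) :=
  fun p k _ => preservesIntegral_ropTotalAE (rep p k)

open Classical in
/-- (0.4) without the guard. [cite: Balaban1989LargeFieldI, (0.4) p.176] -/
theorem preservesIntegral_ROp03AEOfRecord' (rep : RepOfRecord F N) (p : B12.RunParams) (k : ℕ) :
    PreservesIntegral (ROp03AEOfRecord F N rep p k) :=
  preservesIntegral_ropTotalAE (rep p k)

open Classical in
/-- **Integrability is preserved by `R` of record (v1.1)** — fills `Residual₅.integrable_R`. [cite: Balaban1989LargeFieldI, (0.3)–(0.4) p.176 (bookkeeping)] -/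
theorem integrable_ROp03AEOfRecord (rep : RepOfRecord F N) :
    ∀ (p : B12.RunParams) (k : ℕ), k < p.K → ∀ ρ : Density (F.P p.K) (k + 1) (SU N),
      Integrable ρ (fieldMeasure (F.P p.K) (k + 1) (SU N)) →
        Integrable (ROp03AEOfRecord F N rep p k ρ) (fieldMeasure (F.P p.K) (k + 1) (SU N)) :=
  fun p k _ _ hρ => integrable_ropTotalAE (rep p k) hρ

open Classical in
/-- The admissible branch of `R` of record (v1.1) is the explicit (0.3). [cite: Balaban1989LargeFieldI, (0.3) p.176 (bookkeeping)] -/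
theorem ROp03AEOfRecord_of_admissibleAE {rep : RepOfRecord F N} {p : B12.RunParams} {k : ℕ}
    {ρ : Density (F.P p.K) (k + 1) (SU N)} (h : AdmissibleAE (rep p k) ρ) :
    ROp03AEOfRecord F N rep p k ρ = (rep p k ρ).rop :=
  ropTotalAE_of_admissible h

open Classical in
/-- The other branch is the identity. [cite: Balaban1989LargeFieldI, (0.3) p.176 (typing convention)] -/
theorem ROp03AEOfRecord_of_not {rep : RepOfRecord F N} {p : B12.RunParams} {k : ℕ}
    {ρ : Density (F.P p.K) (k + 1) (SU N)} (h : ¬ AdmissibleAE (rep p k) ρ) :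
    ROp03AEOfRecord F N rep p k ρ = ρ :=
  ropTotalAE_of_not h

open Classical in
/-- v1.1 AGREES WITH v1 on v1's own (pointwise) admissible branch. [cite: Balaban1989LargeFieldI, (0.3) p.176 (bookkeeping)] -/
theorem ROp03AEOfRecord_eq_of_admissible {rep : RepOfRecord F N} {p : B12.RunParams} {k : ℕ}
    {ρ : Density (F.P p.K) (k + 1) (SU N)} (h : Admissible (rep p k) ρ) :
    ROp03AEOfRecord F N rep p k ρ = ROp03OfRecord F N rep p k ρ := by
  rw [ROp03AEOfRecord_of_admissibleAE F N (admissibleAE_of_admissible h), ROp03OfRecord_of_admissible F N h]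

open Classical in
/-- `R` of record (v1.1) is non-negative on its admissible branch. [cite: Balaban1989LargeFieldI, (0.3) p.176 («the densities are positive»)] -/
theorem ROp03AEOfRecord_nonneg {rep : RepOfRecord F N} {p : B12.RunParams} {k : ℕ}
    {ρ : Density (F.P p.K) (k + 1) (SU N)} (h : AdmissibleAE (rep p k) ρ) (V : GaugeField (F.P p.K) (k + 1) (SU N)) :
    0 ≤ ROp03AEOfRecord F N rep p k ρ V :=
  ropTotalAE_nonneg h V

end Pin

/-! ## §3  The (R3) pin shape for a represented tower carried as `RepData` -/

section TowerPin

variable (F : T4Family) (N : ℕ) [NeZero N]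

/-- A represented tower of record carried as b01∕n12-b `RepData` per run `p` and step `k` (after `k + 1` steps); dag-n12-b's
`TowerOfRecord` gives one by `fun p k => (T p k).toRepData`. [cite: Balaban1989LargeFieldI, (0.2) p.176, (1.1) p.177] -/
abbrev RepDataTower : Type 1 :=
  (p : B12.RunParams) → (k : ℕ) → RepData (F.P p.K) (k + 1) (SU N)

open Classical in
/-- **THE (R3) PIN SHAPE**: Bałaban's representation data on every density ALMOST EVERYWHERE EQUAL to the tower's own total density, the
one-region convention (`trivialRep`) elsewhere — so that the transported density `Tρ_k` (an `rnDeriv` version) receives the tower's data as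
soon as the a.e. identity is proved. [cite: Balaban1989LargeFieldI, (0.2)–(0.3) p.176] -/
def repOfDataAE (T : RepDataTower F N) : RepOfRecord F N :=
  fun p k ρ => if (T p k).total =ᵐ[fieldMeasure (F.P p.K) (k + 1) (SU N)] ρ then T p k else trivialRep ρ

open Classical in
/-- On a density a.e.-equal to the tower's total the datum is the tower's. [cite: Balaban1989LargeFieldI, (0.2) p.176 (bookkeeping)] -/
theorem repOfDataAE_of_ae (T : RepDataTower F N) {p : B12.RunParams} {k : ℕ} {ρ : Density (F.P p.K) (k + 1) (SU N)}
    (hae : (T p k).total =ᵐ[fieldMeasure (F.P p.K) (k + 1) (SU N)] ρ) : repOfDataAE F N T p k ρ = T p k := by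
  simp [repOfDataAE, hae]

open Classical in
/-- Elsewhere the datum is the one-region convention. [cite: Balaban1989LargeFieldI, (0.2) p.176 (typing convention)] -/
theorem repOfDataAE_of_not_ae (T : RepDataTower F N) {p : B12.RunParams} {k : ℕ} {ρ : Density (F.P p.K) (k + 1) (SU N)}
    (hae : ¬ (T p k).total =ᵐ[fieldMeasure (F.P p.K) (k + 1) (SU N)] ρ) : repOfDataAE F N T p k ρ = trivialRep ρ := by
  simp [repOfDataAE, hae]

open Classical in
/-- Under the a.e. identity and the provisos of p. 176 the tower's datum is a.e.-admissible at `ρ`. [cite: Balaban1989LargeFieldI, (0.3) p.176 (bookkeeping)] -/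
theorem admissibleAE_repOfDataAE_of_ae (T : RepDataTower F N) {p : B12.RunParams} {k : ℕ}
    {ρ : Density (F.P p.K) (k + 1) (SU N)} (hae : (T p k).total =ᵐ[fieldMeasure (F.P p.K) (k + 1) (SU N)] ρ)
    (hprov : (T p k).Provisos) : AdmissibleAE (repOfDataAE F N T p k) ρ := by
  refine ⟨?_, ?_⟩ <;> rw [repOfDataAE_of_ae F N T hae]
  exacts [hae, hprov]

open Classical in
/-- **On a density a.e.-equal to the record's represented one, under the provisos, `R` of record (v1.1) IS the explicit (0.3) of the tower** —
the line DEFINER ₉ ∕ the N12 knit cite once `Tρ_k =ᵐ (T p k).total` is proved. [cite: Balaban1989LargeFieldI, (0.3) p.176] -/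
theorem ROp03AEOfRecord_repOfDataAE_of_ae (T : RepDataTower F N) {p : B12.RunParams} {k : ℕ}
    {ρ : Density (F.P p.K) (k + 1) (SU N)} (hae : (T p k).total =ᵐ[fieldMeasure (F.P p.K) (k + 1) (SU N)] ρ)
    (hprov : (T p k).Provisos) : ROp03AEOfRecord F N (repOfDataAE F N T) p k ρ = (T p k).rop := by
  rw [ROp03AEOfRecord_of_admissibleAE F N (admissibleAE_repOfDataAE_of_ae F N T hae hprov), repOfDataAE_of_ae F N T hae]

end TowerPin

end Literature.MathematicalPhysics.QuantumFieldTheory.Balaban1983to89.Node00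

end
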